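import Summits.ResolutionOfSingularities.ResolutionOfSingularities.Theorems.EquisingularLiftEquisingularLiftNatAffineTwoStepOrigin
import HarnessLib

/-!
# [OURS] THE AFFINE TWO-STEP BRIDGE, PACKAGED: the origin of `Spec K[y]/(Φ + Ψ)` with per-chart second-order data is a TWO-STEP POINT in the towers'
# currency — VERBATIM the `hDsucc` clause (level `1`, with level `0` = one-step) of ✓ `towerLevel_succ_of_model` / the hypothesis `htwo` of
# ✓ `PointChain.chain_of_twoStepPoints` (cruxes `Theses.EquisingularLift.EquisingularLiftNat` / `…NatThree` / `EquisingularLift`, stmt-…-20038 / -20148 / -15660)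

[OURS · leafhand-res-equisingularlift-11 g0, 2026-08-31; cell `pub/decomp-res`] AI-produced, weaker than expert review; NOT a statement of any manuscript;
nothing here proves resolution of singularities in positive characteristic.  DEF-FREE helper; no `sorry`; standard axioms; ZERO named hypotheses.

* ★★★ `OneStep.twoStepAt_origin` — `f = Φ + Ψ ∈ K[y₀,…,y_N]` (`Φ ≠ 0` a form of degree `μ ≥ 1`, `Ψ ∈ (y)^{μ+1}`); for every chart `a` a strict transform `G_a`
  with the total-transform identity and the DISJUNCTIVE Jacobian datum «at every prime `P ∋ T_a, G_a` some `∂_jG_a ∉ P` or `P ⊇ (T)`»; and, for every chart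
  whose origin lies on the strict transform (`G_a ∈ (T)`), a second-order splitting `G_a = Φ'_a + Ψ'_a` (`Φ'_a ≠ 0` a form of degree `μ'_a ≥ 1`,
  `Ψ'_a ∈ (T)^{μ'_a+1}`) with one-step data (hone').  Then for the origin `y₀` and EVERY blow-up `τ : Z → Spec K[y]/(f)` along `vanishingIdeal {y₀}` there
  is a finite `S' ⊆ Z` with `Z` regular at every point over `y₀` off `S'`, every `z ∈ S'` over `y₀`, closed, and ONE-STEP.
  Assembly: ✓ `finite_setOf_not_isRegularLocalRing`, ✓ `exists_chart_origin_of_not_isRegularLocalRing` (p833342), ✓ `oneStepAt_chartOrigin` (…NatAffineTwoStepOrigin),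
  the dictionary `vanishingIdeal {y₀} = ofIdealTop (ȳ)` (✓ `vanishingIdeal_zeroLocus_eq_ofIdealTop_of_isRadical`).

This closes the AFFINE scheme side of level `1`; the polynomial inputs are ✓ …SecondOrderAPoints / …A3Recognition / …ALadder / …DLadder (`A₃`, `A`-ladder,
`D/E` simple roots).  Remaining (S): the transfer to the vertex of `V₊(F) ⊆ ℙⁿ` by ✓ `twoStepAt_iff_of_isIso_morphismRestrict` along the chart immersion, and
the use in ✓ `towerLevel_succ_of_model` / ✓ `chain_of_twoStepPoints` ⟹ `IsoHypPoint` for hypersurfaces whose singular points are first- or second-order.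
Honest label: closes no registered stub.

References: [StacksProject, Tags 0804, 080E]; [GortzWedhorn2020, Prop. 13.91]; through the cited tree files.
-/

set_option linter.dupNamespace false -- mandated namespace `Summit.<Summit>.<Problem>` of this single-conjunct summit

noncomputable section

open CategoryTheory CategoryTheory.Limits AlgebraicGeometry TopologicalSpace Topology
open MvPolynomial
open Literature.AlgebraicGeometry.Resolution
open AlgebraicGeometry.Scheme.IdealSheafData
open Summit.ResolutionOfSingularities.ResolutionOfSingularities.Cruxes.EquisingularLiftNat.Sections.ND

namespace Summit.ResolutionOfSingularities.ResolutionOfSingularities.Cruxes.EquisingularLiftNat.Sections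

namespace OneStep

set_option maxHeartbeats 800000 in -- the chart algebra `blowupAlgebra` is a subalgebra of a localisation: slow instance unification (as in …NatOneStepVertexChart)
/-- ★★★ **THE ORIGIN OF AN AFFINE HYPERSURFACE WITH SECOND-ORDER DATA IS A TWO-STEP POINT** (towers' `hDsucc` clause, level `1`). [OURS]
[cite: StacksProject, Tag 0804] [cite: GortzWedhorn2020, Prop. 13.91] -/
theorem twoStepAt_origin (K : Type) [Field K] {N : ℕ} (Φ Ψ : MvPolynomial (Fin (N + 1)) K) {μ : ℕ} (hμ : 1 ≤ μ)
    (hΦ : Φ.IsHomogeneous μ) (hΦ0 : Φ ≠ 0)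
    (hΨ : Ψ ∈ Ideal.span (Set.range (X : Fin (N + 1) → MvPolynomial (Fin (N + 1)) K)) ^ (μ + 1))
    (G : Fin (N + 1) → MvPolynomial (Fin (N + 1)) K)
    (hG : ∀ a, aeval (fun j => X a * Function.update (X : Fin (N + 1) → MvPolynomial (Fin (N + 1)) K) a 1 j) (Φ + Ψ) = X a ^ μ * G a)
    (hjac : ∀ a, ∀ P : Ideal (MvPolynomial (Fin (N + 1)) K), P.IsPrime → (X a : MvPolynomial (Fin (N + 1)) K) ∈ P → G a ∈ P →
      (∃ j, pderiv j (G a) ∉ P) ∨ ∀ i, (X i : MvPolynomial (Fin (N + 1)) K) ∈ P)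
    (hsec : ∀ a, G a ∈ Ideal.span (Set.range (X : Fin (N + 1) → MvPolynomial (Fin (N + 1)) K)) →
      ∃ (μ' : ℕ) (Φ' Ψ' : MvPolynomial (Fin (N + 1)) K), 1 ≤ μ' ∧ Φ'.IsHomogeneous μ' ∧ Φ' ≠ 0 ∧
        Ψ' ∈ Ideal.span (Set.range (X : Fin (N + 1) → MvPolynomial (Fin (N + 1)) K)) ^ (μ' + 1) ∧ G a = Φ' + Ψ' ∧
        ∀ b : Fin (N + 1), ∃ G' : MvPolynomial (Fin (N + 1)) K,
          aeval (fun j => X b * Function.update (X : Fin (N + 1) → MvPolynomial (Fin (N + 1)) K) b 1 j) (Φ' + Ψ') = X b ^ μ' * G' ∧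
          ∀ P : Ideal (MvPolynomial (Fin (N + 1)) K), P.IsPrime → (X b : MvPolynomial (Fin (N + 1)) K) ∈ P → G' ∈ P → ∃ j, pderiv j G' ∉ P)
    (y₀ : Spec (CommRingCat.of (MvPolynomial (Fin (N + 1)) K ⧸ Ideal.span {Φ + Ψ})))
    (hy₀ : y₀.asIdeal = Ideal.map (Ideal.Quotient.mk (Ideal.span {Φ + Ψ}))
      (Ideal.span (Set.range (X : Fin (N + 1) → MvPolynomial (Fin (N + 1)) K)))) :
    ∀ (hy : IsClosed ({y₀} : Set (Spec (CommRingCat.of (MvPolynomial (Fin (N + 1)) K ⧸ Ideal.span {Φ + Ψ})))))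
      (Z : Scheme.{0}) (τ : Z ⟶ Spec (CommRingCat.of (MvPolynomial (Fin (N + 1)) K ⧸ Ideal.span {Φ + Ψ}))),
      IsBlowup τ (vanishingIdeal ⟨{y₀}, hy⟩) →
      ∃ S' : Finset Z, (∀ z : Z, τ z = y₀ → z ∉ S' → IsRegularLocalRing (Z.presheaf.stalk z)) ∧
        ∀ z ∈ S', τ z = y₀ ∧ ∃ hz : IsClosed ({z} : Set Z), ∀ (Z' : Scheme.{0}) (τ' : Z' ⟶ Z),
          IsBlowup τ' (vanishingIdeal ⟨{z}, hz⟩) → ∀ z' : Z', τ' z' = z → IsRegularLocalRing (Z'.presheaf.stalk z') := by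
  classical
  intro hy Z τ hτ
  -- the dictionary `vanishingIdeal {y₀} = ofIdealTop (ȳ)`
  have hmax := isMaximal_map_mk_span_range_X K Φ Ψ hμ hΦ hΨ
  have hrad : (Ideal.map (Ideal.Quotient.mk (Ideal.span {Φ + Ψ}))
      (Ideal.span (Set.range (X : Fin (N + 1) → MvPolynomial (Fin (N + 1)) K)))).IsRadical := hmax.isPrime.isRadical
  have hsing : ({y₀} : Set (Spec (CommRingCat.of (MvPolynomial (Fin (N + 1)) K ⧸ Ideal.span {Φ + Ψ})))) =
      PrimeSpectrum.zeroLocus ((Ideal.map (Ideal.Quotient.mk (Ideal.span {Φ + Ψ}))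
        (Ideal.span (Set.range (X : Fin (N + 1) → MvPolynomial (Fin (N + 1)) K))) : Set _)) := by
    rw [← hy₀]
    exact singleton_eq_zeroLocus_of_isMaximal y₀ (hy₀ ▸ hmax)
  have hC : (⟨{y₀}, hy⟩ : Closeds (Spec (CommRingCat.of (MvPolynomial (Fin (N + 1)) K ⧸ Ideal.span {Φ + Ψ})))) =
      ⟨PrimeSpectrum.zeroLocus ((Ideal.map (Ideal.Quotient.mk (Ideal.span {Φ + Ψ}))
        (Ideal.span (Set.range (X : Fin (N + 1) → MvPolynomial (Fin (N + 1)) K))) : Set _)), PrimeSpectrum.isClosed_zeroLocus _⟩ :=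
    Closeds.ext hsing
  have hV : vanishingIdeal (⟨{y₀}, hy⟩ : Closeds (Spec (CommRingCat.of (MvPolynomial (Fin (N + 1)) K ⧸ Ideal.span {Φ + Ψ})))) =
      ofIdealTop (Ideal.map (Scheme.ΓSpecIso (CommRingCat.of (MvPolynomial (Fin (N + 1)) K ⧸ Ideal.span {Φ + Ψ}))).inv.hom
        (Ideal.map (Ideal.Quotient.mk (Ideal.span {Φ + Ψ})) (Ideal.span (Set.range (X : Fin (N + 1) → MvPolynomial (Fin (N + 1)) K))))) := by
    rw [hC]
    exact vanishingIdeal_zeroLocus_eq_ofIdealTop_of_isRadical _ hrad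
  have hsupp : ∀ z : Z, τ z = y₀ ↔ τ z ∈ ((ofIdealTop (Ideal.map (Scheme.ΓSpecIso (CommRingCat.of (MvPolynomial (Fin (N + 1)) K ⧸ Ideal.span {Φ + Ψ}))).inv.hom
        (Ideal.map (Ideal.Quotient.mk (Ideal.span {Φ + Ψ})) (Ideal.span (Set.range (X : Fin (N + 1) → MvPolynomial (Fin (N + 1)) K)))))).support :
          Set (Spec (CommRingCat.of (MvPolynomial (Fin (N + 1)) K ⧸ Ideal.span {Φ + Ψ})))) := by
    intro z
    rw [← hV, Scheme.IdealSheafData.coe_support_vanishingIdeal]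
    exact Iff.rfl
  have hτ' := hτ
  rw [hV] at hτ'
  haveI : IsProper τ := hτ.isProper
  -- the finite set of non-regular points over the origin
  obtain ⟨S', hS'⟩ := (finite_setOf_not_isRegularLocalRing K Φ Ψ hΦ hΦ0 hΨ G hG hjac hτ').exists_finset_coe
  refine ⟨S', fun z hz hzS => ?_, fun z hzS => ?_⟩
  · by_contra hreg
    apply hzS
    rw [← Finset.mem_coe, hS']
    exact ⟨(hsupp z).mp hz, hreg⟩
  · have hzS' : z ∈ (S' : Set Z) := Finset.mem_coe.mpr hzS
    rw [hS'] at hzS'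
    obtain ⟨hzs, hzreg⟩ := hzS'
    refine ⟨(hsupp z).mpr hzs, ?_⟩
    obtain ⟨a, χ, φ, hφ, w₀, hχa, hφρ, hw₀, hφw⟩ :=
      exists_chart_origin_of_not_isRegularLocalRing K Φ Ψ hΦ hΦ0 hΨ G hG hjac hτ' z hzs hzreg
    -- the chart origin lies on the strict transform: `G a ∈ (T)`
    have hTmax := isMaximal_span_range_X' K (N := N)
    have hGa : G a ∈ Ideal.span (Set.range (X : Fin (N + 1) → MvPolynomial (Fin (N + 1)) K)) := by
      by_contra hGa
      obtain ⟨y, i, hi, hyi⟩ := hTmax.exists_inv hGa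
      apply w₀.isPrime.ne_top
      rw [hw₀, Ideal.eq_top_iff_one]
      have h1 : (1 : MvPolynomial (Fin (N + 1)) K ⧸ Ideal.span {G a}) ∈
          Ideal.map (Ideal.Quotient.mk (Ideal.span {G a})) (Ideal.span (Set.range (X : Fin (N + 1) → MvPolynomial (Fin (N + 1)) K))) := by
        have e : Ideal.Quotient.mk (Ideal.span {G a}) i = 1 := by
          have h := congrArg (Ideal.Quotient.mk (Ideal.span {G a})) hyi
          rwa [map_add, map_mul, Ideal.Quotient.eq_zero_iff_mem.mpr (Ideal.mem_span_singleton_self (G a)), mul_zero, zero_add,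
            map_one] at h
        rw [← e]
        exact Ideal.mem_map_of_mem _ hi
      simpa using Ideal.mem_map_of_mem χ.toRingHom h1
    obtain ⟨μ', Φ', Ψ', hμ', hΦ', hΦ'0, hΨ', hGeq, hone'⟩ := hsec a hGa
    rw [← hφw]
    revert χ φ w₀
    rw [hGeq]
    intro χ φ hφ w₀ hχa hφρ hw₀ hφw
    exact oneStepAt_chartOrigin K Φ Ψ a Φ' Ψ' hμ' hΦ' hΦ'0 hΨ' hone' χ τ φ w₀ hw₀

end OneStep

end Summit.ResolutionOfSingularities.ResolutionOfSingularities.Cruxes.EquisingularLiftNat.Sections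

end
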